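import Literature.NumberTheory.Sieve.IwaniecAlmostPrimesWCount
import Literature.NumberTheory.Sieve.IwaniecAlmostPrimesQuadraticDispersion
import HarnessLib

/-!
# Iwaniec (1978) for a general quadratic `G`: the `W`-counts in Lemma-4 form ((19)–(20), p. 183) — PROVED

H. Iwaniec, *Almost-primes represented by quadratic polynomials*, Invent. Math. **47** (1978)
171–188, §4 p. 183, and R. J. Lemke Oliver, Acta Arith. **151** (2012) 241–261, p. 248
(`T*(M; n₁, n₂)`), for the sequence `𝒜_G`, `G = aX² + bX + c` (`a > 0`, `c` odd, `G`
irreducible).  General-`G` copy of `IwaniecAlmostPrimesWCount.lean` (fifteenth file of the inline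
proof of `theorem_quadratic`); pure arithmetic, everything PROVED, no named facts.  With
`u = v + ml₁` and `H = l₂ − l₁`,
`G(u + mH) − G(u) = mH · S`, `S = a(2v + m(l₁ + l₂)) + b`,
so for `d = (n₁, n₂)` squarefree and prime to `m`, `d ∣ G(v + ml₂) ⇔ d₂ ∣ S`, `d₂ = d/(d, H)`;
the count VANISHES unless `(d₂, 2a) = 1` (`c` odd forces `a + b` odd at `2`; a prime of `(d₂, a)`
would divide `a, b, c`), and then the condition `d₂ ∣ S` is the class
`Θ ≡ ω_G(μ) = (2a)⁻¹(μ a (2c − l₁ − l₂) − b) (mod d₂)` of `Θ = v + cm` for `m ≡ μ`.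

* `omegaOfG`, `modEq_omegaOfG_iff`, `quadVal_dvd_iff_dtwo_dvd` (the key step),
  `not_dvd_of_not_coprime_dtwoG` (the vanishing cases);
* `windowCountG`, `windowFibreG` (the Lemma-4 window counts over `lemma4FamilyG`),
  `windowCountG_eq_sum_windowFibreG`;
* `wpairG_eq` — **(19) ⇔ (20) for one `m`**; `sum_wpairG_eq_sum_windowCountG` — summed over
  `A < m ≤ t`, `(m, n₁n₂) = 1`: `= [(d₂, 2a) = 1] ∑_{μ mod d₂} P_c(A, t; q, q, d₂, μ, ω_G(μ))`;
* `card_admissibleG_eq` — **the admissible classes**: the `μ` prime to `d₂` with `ω_G(μ)` a root of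
  `G` mod `d₂` number `ρ_G(d₂)` if `(d₂, Δ) = 1` and `0` otherwise (a root `Θ` comes from a unit
  `μ` iff `G'(Θ) = 2aΘ + b` is a unit, and `(2aΘ + b)² ≡ Δ`); this is Lemke Oliver's
  "`ψ((n₁,n₂)/(n₁,n₂,l₁−l₂)) = 0` unless `n₀ ∣ l₁ − l₂`", p. 249;
* `rhoG_div_mul_rhoG`, `rhoG_mul_rhoG_eq` (multiplicativity on the pair).

## References

* H. Iwaniec, Invent. Math. 47 (1978) 171–188, §4 p. 183, (19)–(20) (`IwaniecInventiones1978`).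
* R. J. Lemke Oliver, Acta Arith. 151 (2012) 241–261, pp. 248–249 (`LemkeOliverActaArith2012`).
-/

noncomputable section

open Finset Real

namespace Literature.NumberTheory.Sieve.Iwaniec1978

variable {a b c : ℤ}

/-! ### The class `ω_G(μ)` and the congruence modulo `d₂` -/

/-- The residue class of `Θ` modulo `d₂` prescribed by (20) for `m ≡ μ (mod d₂)`:
`ω_G(μ) = (2a)⁻¹ (μ a (2c − l₁ − l₂) − b) (mod d₂)` (`(d₂, 2a) = 1`).
[cite: IwaniecInventiones1978, §4 p. 183] -/
def omegaOfG (a b : ℤ) (d₂ cc l₁ l₂ μ : ℕ) : ℕ :=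
  ((2 * (a : ZMod d₂))⁻¹ * ((μ : ZMod d₂) * a * (2 * (cc : ZMod d₂) - l₁ - l₂) - b)).val

/-- For `(d₂, 2a) = 1` and `Θ = v + cm`:
`Θ ≡ ω_G(m mod d₂) (mod d₂) ⇔ d₂ ∣ 2av + am(l₁ + l₂) + b`. [folklore] -/
theorem modEq_omegaOfG_iff {d₂ cc l₁ l₂ m v : ℕ} (hd₂ : 0 < d₂) (hcop : (2 * a.natAbs).Coprime d₂) :
    v + cc * m ≡ omegaOfG a b d₂ cc l₁ l₂ (m % d₂) [MOD d₂] ↔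
      (d₂ : ℤ) ∣ 2 * a * v + a * m * (l₁ + l₂) + b := by
  haveI : NeZero d₂ := ⟨hd₂.ne'⟩
  have h2a : IsUnit (2 * (a : ZMod d₂)) := by
    have : ((2 * a : ℤ) : ZMod d₂) = 2 * (a : ZMod d₂) := by push_cast; ring
    rw [← this, ZMod.coe_int_isUnit_iff_isCoprime, Int.isCoprime_iff_gcd_eq_one, Int.gcd_eq_natAbs,
      Int.natAbs_natCast]
    have e : (2 * a).natAbs = 2 * a.natAbs := by rw [Int.natAbs_mul]; rfl
    rw [e]
    first
      | exact hcop
      | exact Nat.coprime_comm.1 hcop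
  rw [← ZMod.natCast_eq_natCast_iff, omegaOfG, ZMod.natCast_zmod_val, ZMod.natCast_mod,
    ← ZMod.intCast_zmod_eq_zero_iff_dvd]
  push_cast
  constructor
  · intro h
    have h' : 2 * (a : ZMod d₂) * ((v : ZMod d₂) + cc * m) =
        (m : ZMod d₂) * a * (2 * cc - l₁ - l₂) - b := by
      rw [h, ← mul_assoc, ZMod.mul_inv_of_unit _ h2a, one_mul]
    linear_combination h'
  · intro h
    have h' : 2 * (a : ZMod d₂) * ((v : ZMod d₂) + cc * m) =
        (m : ZMod d₂) * a * (2 * cc - l₁ - l₂) - b := by linear_combination h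
    calc (v : ZMod d₂) + cc * m = (2 * (a : ZMod d₂))⁻¹ * (2 * (a : ZMod d₂) * ((v : ZMod d₂) + cc * m)) := by
          rw [← mul_assoc, ZMod.inv_mul_of_unit _ h2a, one_mul]
      _ = (2 * (a : ZMod d₂))⁻¹ * ((m : ZMod d₂) * a * (2 * cc - l₁ - l₂) - b) := by rw [h']

/-! ### The congruence modulo `d`: `d ∣ G(u + mH) ⇔ d₂ ∣ S` -/

/-- **The key step of (19) ⇒ (20) for `G`**: if `d` is squarefree, `(m, d) = 1` and
`d ∣ G(v + m l₁)`, then `d ∣ G(v + m l₂) ⇔ d₂ ∣ 2av + am(l₁ + l₂) + b`, `d₂ = d/(d, l₁ − l₂)`: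
indeed `G(v + ml₂) − G(v + ml₁) = m (l₂ − l₁)(a(2v + m(l₁ + l₂)) + b)` and `(d₂, l₂ − l₁) = 1`.
[cite: IwaniecInventiones1978, §4 p. 183] -/
theorem quadVal_dvd_iff_dtwo_dvd {d m v l₁ l₂ : ℕ} (hd : Squarefree d) (hmd : m.Coprime d)
    (h₁ : (d : ℤ) ∣ quadVal a b c (v + m * l₁ : ℕ)) :
    (d : ℤ) ∣ quadVal a b c (v + m * l₂ : ℕ) ↔
      (dtwo d l₁ l₂ : ℤ) ∣ 2 * a * v + a * m * (l₁ + l₂) + b := by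
  set d₁ := Nat.gcd d (Int.natAbs ((l₁ : ℤ) - l₂)) with hd₁
  set d₂ := dtwo d l₁ l₂ with hd₂
  set H : ℤ := (l₂ : ℤ) - l₁ with hH
  set S : ℤ := 2 * a * v + a * m * (l₁ + l₂) + b with hS
  have hprod : d₁ * d₂ = d := gcd_mul_dtwo d l₁ l₂
  obtain ⟨-, hcopH⟩ := coprime_dtwo hd l₁ l₂
  have hident : quadVal a b c (v + m * l₂ : ℕ) - quadVal a b c (v + m * l₁ : ℕ) = (m : ℤ) * H * S := by
    rw [hS, hH]; simp only [quadVal]; push_cast; ring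
  have hd₁H : (d₁ : ℤ) ∣ H := by
    have : d₁ ∣ Int.natAbs ((l₁ : ℤ) - l₂) := Nat.gcd_dvd_right _ _
    have h' : (d₁ : ℤ) ∣ (l₁ : ℤ) - l₂ := Int.natCast_dvd.mpr this
    have : H = -((l₁ : ℤ) - l₂) := by rw [hH]; ring
    rw [this]; exact h'.neg_right
  have hcop2 : IsCoprime (d₂ : ℤ) H := by
    rw [Int.isCoprime_iff_gcd_eq_one, Int.gcd_eq_natAbs, Int.natAbs_natCast]
    have e : H.natAbs = Int.natAbs ((l₁ : ℤ) - l₂) := by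
      rw [hH, ← Int.natAbs_neg]; congr 1; ring
    rw [e]; exact hcopH
  have hcopm : IsCoprime (d : ℤ) (m : ℤ) := Nat.isCoprime_iff_coprime.mpr hmd.symm
  constructor
  · intro h₂
    have hdiff : (d : ℤ) ∣ (m : ℤ) * H * S := by rw [← hident]; exact dvd_sub h₂ h₁
    have h3 : (d : ℤ) ∣ H * S := by
      rw [mul_assoc] at hdiff
      exact hcopm.dvd_of_dvd_mul_left hdiff
    have h4 : (d₂ : ℤ) ∣ H * S := (Int.natCast_dvd_natCast.mpr (hd₂ ▸ dtwo_dvd d l₁ l₂)).trans h3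
    exact hcop2.dvd_of_dvd_mul_left h4
  · intro h₂
    have h3 : (d : ℤ) ∣ H * S := by
      rw [← hprod]; push_cast
      exact mul_dvd_mul hd₁H h₂
    have h4 : (d : ℤ) ∣ (m : ℤ) * H * S := by rw [mul_assoc]; exact h3.mul_left _
    rw [← hident] at h4
    have h5 := dvd_add h4 h₁
    rw [sub_add_cancel] at h5
    exact h5

/-- `2 ∣ G(k)` forces `a + b` odd and `k` odd when `c` is odd (`G(k) ≡ (a + b)k + c (mod 2)`).
[folklore] -/
theorem odd_add_of_two_dvd_quadVal (hc : Odd c) {k : ℤ} (h : (2 : ℤ) ∣ quadVal a b c k) :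
    Odd (a + b) ∧ Odd k := by
  have hE : Even (a * k ^ 2 + b * k + c) := even_iff_two_dvd.2 h
  have hc' : ¬ Even c := Int.not_even_iff_odd.2 hc
  have hX : ¬ Even (a * k ^ 2 + b * k) := fun hX => hc' ((Int.even_add.1 hE).1 hX)
  rcases Int.even_or_odd k with hk | hk
  · exfalso
    apply hX
    rw [Int.even_add, Int.even_mul, Int.even_mul, Int.even_pow]
    exact ⟨fun _ => Or.inr hk, fun _ => Or.inr ⟨hk, two_ne_zero⟩⟩
  · refine ⟨?_, hk⟩
    have hk' : ¬ Even k := Int.not_even_iff_odd.2 hk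
    rw [← Int.not_even_iff_odd, Int.even_add]
    intro hab
    apply hX
    rw [Int.even_add, Int.even_mul, Int.even_mul, Int.even_pow]
    tauto

/-- **The vanishing cases**: if `d` is squarefree, `(m, d) = 1`, `d ∣ G(v + ml₁)` and `(d₂, 2a) ≠ 1`,
then `d ∤ G(v + ml₂)` (a prime `p ∣ (d₂, a)` would divide `S ≡ b` and then `a, b, c`; for
`2 ∣ d₂`, `c` odd forces `a + b` odd and `v + ml₁` odd, and then `S` is odd if `a` is even, while
for `a` odd `2 ∣ S` forces `2 ∣ l₁ − l₂`, against `(d₂, (d, l₁ − l₂)) = 1`).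
[cite: IwaniecInventiones1978, §4 p. 183] -/
theorem not_dvd_of_not_coprime_dtwoG (ha : 0 < a) (hc : Odd c) (hirr : Irreducible (quadPoly a b c))
    {d m v l₁ l₂ : ℕ} (hd : Squarefree d) (hmd : m.Coprime d)
    (hbad : ¬ (2 * a.natAbs).Coprime (dtwo d l₁ l₂))
    (h₁ : (d : ℤ) ∣ quadVal a b c (v + m * l₁ : ℕ)) : ¬ (d : ℤ) ∣ quadVal a b c (v + m * l₂ : ℕ) := by
  intro h₂
  set d₂ := dtwo d l₁ l₂ with hd₂
  have hS := (quadVal_dvd_iff_dtwo_dvd hd hmd h₁).mp h₂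
  rw [← hd₂] at hS
  have hd₂d : d₂ ∣ d := dtwo_dvd d l₁ l₂
  rw [Nat.coprime_iff_gcd_eq_one] at hbad
  obtain ⟨p, hp, hpg⟩ := Nat.exists_prime_and_dvd hbad
  have hp2a : p ∣ 2 * a.natAbs := hpg.trans (Nat.gcd_dvd_left _ _)
  have hpd₂ : p ∣ d₂ := hpg.trans (Nat.gcd_dvd_right _ _)
  have hpdN : p ∣ d := hpd₂.trans hd₂d
  have hpd : (p : ℤ) ∣ d := Int.natCast_dvd_natCast.2 hpdN
  have hpS : (p : ℤ) ∣ 2 * a * v + a * m * (l₁ + l₂) + b := (Int.natCast_dvd_natCast.2 hpd₂).trans hS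
  have hpG : (p : ℤ) ∣ quadVal a b c (v + m * l₁ : ℕ) := hpd.trans h₁
  have hpm : ¬ (p : ℤ) ∣ m := by
    intro h
    have : p ∣ Nat.gcd m d := Nat.dvd_gcd (Int.natCast_dvd_natCast.1 h) hpdN
    rw [hmd] at this; exact hp.one_lt.ne' (Nat.dvd_one.1 this)
  by_cases hpa : (p : ℤ) ∣ a
  · -- `p ∣ a`: then `p ∣ b` from `S`, and `p ∣ c` from `G`, contradicting irreducibility
    have hpb : (p : ℤ) ∣ b := by
      have h' : (p : ℤ) ∣ 2 * a * v + a * m * (l₁ + l₂) :=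
        dvd_add (dvd_mul_of_dvd_left (dvd_mul_of_dvd_right hpa 2) _)
          (dvd_mul_of_dvd_left (dvd_mul_of_dvd_left hpa _) _)
      have := dvd_sub hpS h'
      rwa [add_sub_cancel_left] at this
    have hpc : (p : ℤ) ∣ c := by
      simp only [quadVal] at hpG
      have h' : (p : ℤ) ∣ a * ((v + m * l₁ : ℕ) : ℤ) ^ 2 + b * ((v + m * l₁ : ℕ) : ℤ) :=
        dvd_add (dvd_mul_of_dvd_left hpa _) (dvd_mul_of_dvd_left hpb _)
      have := dvd_sub hpG h'
      rwa [add_sub_cancel_left] at this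
    exact false_of_prime_dvd_coeffs ha.ne' hirr hp hpa hpb hpc
  · -- `p ∤ a`: then `p = 2`
    have hp2 : p = 2 := by
      have h2 : p ∣ 2 := by
        rcases (Nat.Prime.dvd_mul hp).1 hp2a with h | h
        · exact h
        · exact absurd (Int.natCast_dvd.2 h) hpa
      exact (Nat.prime_dvd_prime_iff_eq hp Nat.prime_two).1 h2
    subst hp2
    push_cast at hpa hpm hpS hpG
    -- `c` odd: `a + b` odd and `k = v + m l₁` odd
    obtain ⟨hab, -⟩ := odd_add_of_two_dvd_quadVal hc hpG
    have haodd : Odd a := Int.not_even_iff_odd.1 (fun h => hpa (even_iff_two_dvd.1 h))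
    have hbev : Even b := by
      rcases Int.even_or_odd b with h | h
      · exact h
      · exact absurd (haodd.add_odd h) (Int.not_even_iff_odd.2 hab)
    have hmodd : Odd (m : ℤ) := Int.not_even_iff_odd.1 (fun h => hpm (even_iff_two_dvd.1 h))
    -- `S = 2av + a m (l₁ + l₂) + b` even forces `l₁ + l₂` even
    have hsum : Even ((l₁ : ℤ) + l₂) := by
      have h1 : (2 : ℤ) ∣ a * m * (l₁ + l₂) := by
        have e : a * (m : ℤ) * (l₁ + l₂) = (2 * a * v + a * m * (l₁ + l₂) + b) - b - 2 * (a * v) := by ring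
        rw [e]
        exact dvd_sub (dvd_sub hpS hbev.two_dvd) (dvd_mul_right 2 _)
      rw [← even_iff_two_dvd] at h1
      rcases Int.even_mul.1 h1 with h | h
      · rcases Int.even_mul.1 h with h' | h'
        · exact absurd h' (Int.not_even_iff_odd.2 haodd)
        · exact absurd h' (Int.not_even_iff_odd.2 hmodd)
      · exact h
    -- hence `2 ∣ l₁ − l₂`, so `2 ∣ (d, |l₁ − l₂|)`, contradicting `(d₂, (d, |l₁−l₂|)) = 1`
    have hdiff : 2 ∣ Int.natAbs ((l₁ : ℤ) - l₂) := by
      have : (2 : ℤ) ∣ (l₁ : ℤ) - l₂ := by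
        have e : (l₁ : ℤ) - l₂ = ((l₁ : ℤ) + l₂) - 2 * l₂ := by ring
        rw [e]; exact dvd_sub hsum.two_dvd (dvd_mul_right 2 _)
      exact Int.natCast_dvd.mp this
    have hd₁ : 2 ∣ Nat.gcd d (Int.natAbs ((l₁ : ℤ) - l₂)) := Nat.dvd_gcd hpdN hdiff
    obtain ⟨hcop, -⟩ := coprime_dtwo hd l₁ l₂
    have : 2 ∣ Nat.gcd (dtwo d l₁ l₂) (Nat.gcd d (Int.natAbs ((l₁ : ℤ) - l₂))) := Nat.dvd_gcd hpd₂ hd₁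
    rw [hcop] at this
    omega

/-! ### The Lemma-4 window counts for `𝒜_G` -/

/-- The count of Lemma 4 in integer form for `G`:
`P_c(A, t) = #{(m, Θ) ∈ lemma4FamilyG a b c q Q d μ ω A t : ⌊Θ/m⌋ = c}`.
[cite: IwaniecInventiones1978, Lemma 4] -/
def windowCountG (a b c : ℤ) (q Q d μ ω A t cc : ℕ) : ℕ :=
  ((lemma4FamilyG a b c q Q d μ ω A t).filter (fun p : ℕ × ℕ => p.2 / p.1 = cc)).card

/-- The fibre of the window count at `m`: `[(m,Q)=1, m ≡ μ (d)] · #{Θ root of G mod mq :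
Θ ≡ ω (d), ⌊Θ/m⌋ = c}`. [cite: IwaniecInventiones1978, Lemma 4] -/
def windowFibreG (a b c : ℤ) (q Q d μ ω cc m : ℕ) : ℕ :=
  if m.Coprime Q ∧ m ≡ μ [MOD d] then
    ((rootsG a b c (m * q)).filter (fun Θ => Θ ≡ ω [MOD d] ∧ Θ / m = cc)).card else 0

/-- A weighted window sum over the family is the `m`-sum of the fibres. [folklore] -/
theorem sum_window_familyG_eq (q Q d μ ω A t cc : ℕ) (g : ℕ → ℝ) :
    ∑ p ∈ (lemma4FamilyG a b c q Q d μ ω A t).filter (fun p : ℕ × ℕ => p.2 / p.1 = cc), g p.1 =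
      ∑ m ∈ Finset.Ioc A t, (windowFibreG a b c q Q d μ ω cc m : ℝ) * g m := by
  classical
  set fam := (lemma4FamilyG a b c q Q d μ ω A t).filter (fun p : ℕ × ℕ => p.2 / p.1 = cc) with hfam
  have hmaps : ∀ p ∈ fam, p.1 ∈ Finset.Ioc A t := by
    intro p hp
    rw [hfam, Finset.mem_filter, mem_lemma4FamilyG] at hp
    rw [Finset.mem_Ioc]; exact hp.1.1
  rw [← Finset.sum_fiberwise_of_maps_to hmaps]
  refine Finset.sum_congr rfl fun m hm => ?_
  rw [Finset.mem_Ioc] at hm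
  have hconst : ∀ p ∈ fam.filter (fun p : ℕ × ℕ => p.1 = m), g p.1 = g m := by
    intro p hp; rw [Finset.mem_filter] at hp; rw [hp.2]
  rw [Finset.sum_congr rfl hconst, Finset.sum_const, nsmul_eq_mul]
  congr 1
  unfold windowFibreG
  by_cases hcond : m.Coprime Q ∧ m ≡ μ [MOD d]
  · rw [if_pos hcond]
    norm_cast
    refine Finset.card_bij (fun p _ => p.2) ?_ ?_ ?_
    · intro p hp
      rw [Finset.mem_filter, hfam, Finset.mem_filter, mem_lemma4FamilyG] at hp
      obtain ⟨⟨⟨-, -, -, h4, h5⟩, hwin⟩, rfl⟩ := hp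
      exact Finset.mem_filter.mpr ⟨h4, h5, hwin⟩
    · intro x hx y hy hxy
      rw [Finset.mem_filter] at hx hy
      exact Prod.ext (hx.2.trans hy.2.symm) hxy
    · intro Θ hΘ
      rw [Finset.mem_filter] at hΘ
      refine ⟨(m, Θ), ?_, rfl⟩
      rw [Finset.mem_filter, hfam, Finset.mem_filter, mem_lemma4FamilyG]
      exact ⟨⟨⟨hm, hcond.1, hcond.2, hΘ.1, hΘ.2.1⟩, hΘ.2.2⟩, rfl⟩
  · rw [if_neg hcond]
    norm_cast
    rw [Finset.card_eq_zero, Finset.filter_eq_empty_iff]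
    intro p hp hpm
    rw [hfam, Finset.mem_filter, mem_lemma4FamilyG] at hp
    rw [hpm] at hp
    exact hcond ⟨hp.1.2.1, hp.1.2.2.1⟩

/-- The window count as the `m`-sum of its fibres. [folklore] -/
theorem windowCountG_eq_sum_windowFibreG (q Q d μ ω A t cc : ℕ) :
    (windowCountG a b c q Q d μ ω A t cc : ℝ) =
      ∑ m ∈ Finset.Ioc A t, (windowFibreG a b c q Q d μ ω cc m : ℝ) := by
  unfold windowCountG
  rw [Finset.card_eq_sum_ones, Nat.cast_sum]
  push_cast
  have := sum_window_familyG_eq (a := a) (b := b) (c := c) q Q d μ ω A t cc (fun _ => (1 : ℝ))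
  simp only [mul_one] at this
  rw [← this]

/-! ### The `W`-count for one modulus in Lemma-4 form -/

/-- Divisibility of `G` at congruent arguments. [folklore] -/
theorem natCast_dvd_quadVal_iff_of_modEq {n : ℕ} {x y : ℕ} (h : x ≡ y [MOD n]) :
    (n : ℤ) ∣ quadVal a b c x ↔ (n : ℤ) ∣ quadVal a b c y :=
  ⟨dvd_quadVal_of_modEq (Int.natCast_modEq_iff.2 h), dvd_quadVal_of_modEq (Int.natCast_modEq_iff.2 h.symm)⟩

/-- Divisibility of `|G|` at congruent arguments. [folklore] -/
theorem dvd_gAbs_iff_of_modEq {n x y : ℕ} (h : x ≡ y [MOD n]) :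
    n ∣ gAbs a b c x ↔ n ∣ gAbs a b c y := by
  rw [dvd_gAbs_iff, dvd_gAbs_iff]
  exact natCast_dvd_quadVal_iff_of_modEq h

section PerModulus

variable {n₁ n₂ : ℕ}

/-- **The conditions (19) ⇔ (20) for one `m`, for `𝒜_G`** (p. 183): for `n₁, n₂` squarefree,
`(m, n₁) = (m, n₂) = 1`, `m ≥ 1`, with `d = (n₁,n₂)`, `q = [n₁,n₂]`, `c = crtc`, `d₂ = dtwo d l₁ l₂`:
if `(d₂, 2a) ≠ 1` the count `wpairG` vanishes, and otherwise it equals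
`#{Θ root of G mod mq, 0 ≤ Θ < mq : ⌊Θ/m⌋ = c, Θ ≡ ω_G(m mod d₂) (mod d₂)}` (`v ↦ Θ = v + cm`).
[cite: IwaniecInventiones1978, §4 p. 183] -/
theorem wpairG_eq (ha : 0 < a) (hc : Odd c) (hirr : Irreducible (quadPoly a b c))
    (hn₁ : Squarefree n₁) (hn₂ : Squarefree n₂) {m : ℕ} (hm : 0 < m)
    (hm₁ : m.Coprime n₁) (hm₂ : m.Coprime n₂) (l₁ l₂ : ℕ) :
    wpairG a b c m n₁ n₂ l₁ l₂ =
      if ¬ (2 * a.natAbs).Coprime (dtwo (Nat.gcd n₁ n₂) l₁ l₂) then 0 else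
        ((rootsG a b c (m * Nat.lcm n₁ n₂)).filter (fun Θ => Θ / m = crtc n₁ n₂ l₁ l₂ ∧
          Θ ≡ omegaOfG a b (dtwo (Nat.gcd n₁ n₂) l₁ l₂) (crtc n₁ n₂ l₁ l₂) l₁ l₂
            (m % dtwo (Nat.gcd n₁ n₂) l₁ l₂) [MOD dtwo (Nat.gcd n₁ n₂) l₁ l₂])).card := by
  classical
  have hn₁0 : n₁ ≠ 0 := hn₁.ne_zero
  have hn₂0 : n₂ ≠ 0 := hn₂.ne_zero
  set d := Nat.gcd n₁ n₂ with hd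
  set e := n₂ / d with he
  set q := Nat.lcm n₁ n₂ with hq
  set cc := crtc n₁ n₂ l₁ l₂ with hcc
  set d₂ := dtwo d l₁ l₂ with hd₂
  have hdpos : 0 < d := Nat.gcd_pos_of_pos_left _ (Nat.pos_of_ne_zero hn₁0)
  have hdsq : Squarefree d := hn₁.squarefree_of_dvd (Nat.gcd_dvd_left _ _)
  have hed : e * d = n₂ := Nat.div_mul_cancel (Nat.gcd_dvd_right n₁ n₂)
  have hedc : e.Coprime d := by
    have := hn₂; rw [← hed, Nat.squarefree_mul_iff] at this; exact this.1
  obtain ⟨hn₁e, hqeq⟩ := coprime_div_gcd_of_squarefree hn₂ hn₁0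
  rw [← hd, ← he] at hn₁e
  rw [← hq, ← hd, ← he] at hqeq
  obtain ⟨hc₁, hc₂, hcq⟩ := crtc_spec hn₂ hn₁0 l₁ l₂
  rw [← hcc] at hc₁
  rw [← hcc, ← hd, ← he] at hc₂
  rw [← hcc, ← hq] at hcq
  have hmd : m.Coprime d := Nat.Coprime.coprime_dvd_right (Nat.gcd_dvd_left _ _) hm₁
  have hme : m.Coprime e := Nat.Coprime.coprime_dvd_right (Dvd.intro d hed) hm₂
  have hdn₁ : d ∣ n₁ := Nat.gcd_dvd_left _ _
  have hd₂pos : 0 < d₂ := dtwo_pos hdpos l₁ l₂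
  -- the transport of the conditions
  have hmod₁ : ∀ v : ℕ, v + cc * m ≡ v + m * l₁ [MOD n₁] := by
    intro v
    have h := hc₁.mul_left m
    rw [show m * cc = cc * m from mul_comm _ _] at h
    exact h.add_left v
  have hmod₂ : ∀ v : ℕ, v + cc * m ≡ v + m * l₂ [MOD e] := by
    intro v
    have h := hc₂.mul_left m
    rw [show m * cc = cc * m from mul_comm _ _] at h
    exact h.add_left v
  have hmodm : ∀ v : ℕ, v + cc * m ≡ v [MOD m] := by
    intro v; rw [Nat.ModEq, Nat.add_mul_mod_self_right]
  -- `A ⇔ B` for a root `v` mod `m`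
  have hkey : ∀ v : ℕ, m ∣ gAbs a b c v →
      ((n₁ ∣ gAbs a b c (v + m * l₁) ∧ n₂ ∣ gAbs a b c (v + m * l₂)) ↔
        (m * q ∣ gAbs a b c (v + cc * m) ∧ (d₂ : ℤ) ∣ 2 * a * v + a * m * (l₁ + l₂) + b)) := by
    intro v hv
    constructor
    · rintro ⟨h₁, h₂⟩
      have hd1 : (d : ℤ) ∣ quadVal a b c (v + m * l₁ : ℕ) := dvd_gAbs_iff.1 (hdn₁.trans h₁)
      have hd2 : (d : ℤ) ∣ quadVal a b c (v + m * l₂ : ℕ) :=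
        dvd_gAbs_iff.1 ((Dvd.intro_left e hed).trans h₂)
      refine ⟨?_, (quadVal_dvd_iff_dtwo_dvd hdsq hmd hd1).mp hd2⟩
      rw [hqeq]
      have hA : m ∣ gAbs a b c (v + cc * m) := (dvd_gAbs_iff_of_modEq (hmodm v)).2 hv
      have hB : n₁ ∣ gAbs a b c (v + cc * m) := (dvd_gAbs_iff_of_modEq (hmod₁ v)).2 h₁
      have hC : e ∣ gAbs a b c (v + cc * m) :=
        (dvd_gAbs_iff_of_modEq (hmod₂ v)).2 ((Dvd.intro d hed).trans h₂)
      rw [← mul_assoc]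
      exact (Nat.Coprime.mul_left hme hn₁e).mul_dvd_of_dvd_of_dvd (hm₁.mul_dvd_of_dvd_of_dvd hA hB) hC
    · rintro ⟨hmq, hS⟩
      rw [hqeq, ← mul_assoc] at hmq
      have hB : n₁ ∣ gAbs a b c (v + cc * m) := (dvd_mul_left n₁ m).trans ((dvd_mul_right _ e).trans hmq)
      have hC : e ∣ gAbs a b c (v + cc * m) := (dvd_mul_left e _).trans hmq
      have h₁ : n₁ ∣ gAbs a b c (v + m * l₁) := (dvd_gAbs_iff_of_modEq (hmod₁ v)).1 hB
      have h₂e : e ∣ gAbs a b c (v + m * l₂) := (dvd_gAbs_iff_of_modEq (hmod₂ v)).1 hC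
      have hd1 : (d : ℤ) ∣ quadVal a b c (v + m * l₁ : ℕ) := dvd_gAbs_iff.1 (hdn₁.trans h₁)
      have h₂d : d ∣ gAbs a b c (v + m * l₂) :=
        dvd_gAbs_iff.2 ((quadVal_dvd_iff_dtwo_dvd hdsq hmd hd1).mpr hS)
      refine ⟨h₁, ?_⟩
      rw [← hed]
      exact hedc.mul_dvd_of_dvd_of_dvd h₂e h₂d
  by_cases hgood : (2 * a.natAbs).Coprime d₂
  · -- Case `(d₂, 2a) = 1`: the bijection `v ↦ v + c m`
    rw [if_neg (not_not_intro hgood)]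
    unfold wpairG
    refine Finset.card_bij (fun v _ => v + cc * m) ?_ ?_ ?_
    · intro v hv
      rw [Finset.mem_filter, mem_rootsG] at hv
      obtain ⟨⟨hvm, hvroot⟩, hA⟩ := hv
      have hvroot' : m ∣ gAbs a b c v := dvd_gAbs_iff.2 hvroot
      obtain ⟨hmq, hS⟩ := (hkey v hvroot').mp hA
      rw [Finset.mem_filter, mem_rootsG]
      refine ⟨⟨?_, by exact_mod_cast dvd_gAbs_iff.1 hmq⟩, ?_, (modEq_omegaOfG_iff hd₂pos hgood).mpr hS⟩
      · calc v + cc * m < m + cc * m := Nat.add_lt_add_right hvm _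
          _ = (cc + 1) * m := by ring
          _ ≤ q * m := Nat.mul_le_mul_right m hcq
          _ = m * q := mul_comm _ _
      · rw [Nat.add_mul_div_right _ _ hm, Nat.div_eq_of_lt hvm, zero_add]
    · intro x _ y _ h
      exact Nat.add_right_cancel h
    · intro Θ hΘ
      rw [Finset.mem_filter, mem_rootsG] at hΘ
      obtain ⟨⟨hΘlt, hΘroot⟩, hdiv, hω⟩ := hΘ
      have hΘeq : Θ % m + cc * m = Θ := by
        have := Nat.mod_add_div Θ m
        rw [hdiv] at this
        linarith
      refine ⟨Θ % m, ?_, hΘeq⟩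
      have hΘroot' : m * q ∣ gAbs a b c Θ := dvd_gAbs_iff.2 (by exact_mod_cast hΘroot)
      have hvroot : m ∣ gAbs a b c (Θ % m) :=
        (dvd_gAbs_iff_of_modEq (Nat.mod_modEq Θ m)).2 ((dvd_mul_right m q).trans hΘroot')
      rw [Finset.mem_filter, mem_rootsG]
      refine ⟨⟨Nat.mod_lt _ hm, dvd_gAbs_iff.1 hvroot⟩, ?_⟩
      refine (hkey (Θ % m) hvroot).mpr ⟨hΘeq.symm ▸ hΘroot', ?_⟩
      rw [← hΘeq] at hω
      exact (modEq_omegaOfG_iff hd₂pos hgood).mp hω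
  · -- Case `(d₂, 2a) ≠ 1`: the count vanishes.
    rw [if_pos hgood]
    unfold wpairG
    rw [Finset.card_eq_zero, Finset.filter_eq_empty_iff]
    rintro v - ⟨h₁, h₂⟩
    have hd1 : (d : ℤ) ∣ quadVal a b c (v + m * l₁ : ℕ) := dvd_gAbs_iff.1 (hdn₁.trans h₁)
    have hd2 : (d : ℤ) ∣ quadVal a b c (v + m * l₂ : ℕ) :=
      dvd_gAbs_iff.1 ((Dvd.intro_left e hed).trans h₂)
    exact not_dvd_of_not_coprime_dtwoG ha hc hirr hdsq hmd hgood hd1 hd2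

end PerModulus

/-! ### Summing over `m`: the classes modulo `d₂` and the Lemma-4 window counts -/

section Sum

variable {n₁ n₂ : ℕ}

/-- **The `W`-count for fixed `(l₁, l₂)` as a sum of Lemma-4 window counts over the classes
`μ = m mod d₂`**, for `𝒜_G`:
`∑_{A<m≤t, (m,n₁n₂)=1} wpairG(m) = [(d₂, 2a) = 1] ∑_{μ mod d₂} P_c(A, t; q, q, d₂, μ, ω_G(μ))`.
[cite: IwaniecInventiones1978, §4 p. 183] -/
theorem sum_wpairG_eq_sum_windowCountG (ha : 0 < a) (hc : Odd c) (hirr : Irreducible (quadPoly a b c))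
    (hn₁ : Squarefree n₁) (hn₂ : Squarefree n₂) (l₁ l₂ A t : ℕ) :
    ∑ m ∈ (Finset.Ioc A t).filter (fun m : ℕ => n₁.Coprime m ∧ n₂.Coprime m),
        (wpairG a b c m n₁ n₂ l₁ l₂ : ℝ) =
      if ¬ (2 * a.natAbs).Coprime (dtwo (Nat.gcd n₁ n₂) l₁ l₂) then 0 else
        ∑ μ ∈ Finset.range (dtwo (Nat.gcd n₁ n₂) l₁ l₂),
          (windowCountG a b c (Nat.lcm n₁ n₂) (Nat.lcm n₁ n₂) (dtwo (Nat.gcd n₁ n₂) l₁ l₂) μ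
            (omegaOfG a b (dtwo (Nat.gcd n₁ n₂) l₁ l₂) (crtc n₁ n₂ l₁ l₂) l₁ l₂ μ) A t
            (crtc n₁ n₂ l₁ l₂) : ℝ) := by
  classical
  have hn₁0 : n₁ ≠ 0 := hn₁.ne_zero
  set d := Nat.gcd n₁ n₂ with hd
  set d₂ := dtwo d l₁ l₂ with hd₂
  set q := Nat.lcm n₁ n₂ with hq
  set cc := crtc n₁ n₂ l₁ l₂ with hcc
  have hd₂pos : 0 < d₂ :=
    dtwo_pos (Nat.gcd_pos_of_pos_left _ (Nat.pos_of_ne_zero hn₁0)) l₁ l₂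
  by_cases hgood : (2 * a.natAbs).Coprime d₂
  swap
  · -- the vanishing case
    rw [if_pos hgood]
    refine Finset.sum_eq_zero fun m hm => ?_
    rw [Finset.mem_filter, Finset.mem_Ioc] at hm
    rw [wpairG_eq ha hc hirr hn₁ hn₂ (by omega) hm.2.1.symm hm.2.2.symm l₁ l₂, ← hd, ← hd₂, if_pos hgood]
    simp
  rw [if_neg (not_not_intro hgood)]
  have hper : ∀ m ∈ (Finset.Ioc A t).filter (fun m : ℕ => n₁.Coprime m ∧ n₂.Coprime m),
      (wpairG a b c m n₁ n₂ l₁ l₂ : ℝ) =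
        (((rootsG a b c (m * q)).filter (fun Θ => Θ / m = cc ∧
          Θ ≡ omegaOfG a b d₂ cc l₁ l₂ (m % d₂) [MOD d₂])).card : ℝ) := by
    intro m hm
    rw [Finset.mem_filter, Finset.mem_Ioc] at hm
    rw [wpairG_eq ha hc hirr hn₁ hn₂ (by omega) hm.2.1.symm hm.2.2.symm l₁ l₂, ← hd, ← hd₂, ← hq, ← hcc,
      if_neg (not_not_intro hgood)]
  rw [Finset.sum_congr rfl hper]
  simp_rw [windowCountG_eq_sum_windowFibreG]
  rw [Finset.sum_comm, Finset.sum_filter]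
  refine Finset.sum_congr rfl fun m hm => ?_
  rw [Finset.mem_Ioc] at hm
  have hμ : ∀ μ ∈ Finset.range d₂, μ ≠ m % d₂ →
      (windowFibreG a b c q q d₂ μ (omegaOfG a b d₂ cc l₁ l₂ μ) cc m : ℝ) = 0 := by
    intro μ hμr hne
    rw [Finset.mem_range] at hμr
    unfold windowFibreG
    rw [if_neg]
    · simp
    · rintro ⟨-, hmod⟩
      apply hne
      rw [Nat.ModEq, Nat.mod_eq_of_lt hμr] at hmod
      exact hmod.symm
  rw [Finset.sum_eq_single_of_mem (m % d₂) (Finset.mem_range.mpr (Nat.mod_lt _ hd₂pos)) hμ]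
  unfold windowFibreG
  have hmodself : m ≡ m % d₂ [MOD d₂] := (Nat.mod_modEq m d₂).symm
  by_cases hcop : n₁.Coprime m ∧ n₂.Coprime m
  · have hcq : m.Coprime q := coprime_lcm_iff.mpr ⟨hcop.1.symm, hcop.2.symm⟩
    rw [if_pos hcop, if_pos ⟨hcq, hmodself⟩]
    congr 2
    exact Finset.filter_congr fun Θ _ => and_comm
  · rw [if_neg hcop, if_neg]
    · simp
    · rintro ⟨hcq, -⟩
      have := coprime_lcm_iff.mp hcq
      exact hcop ⟨this.1.symm, this.2.symm⟩

/-- `ρ_G(d)` as a count in `ZMod d`. [folklore] -/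
theorem rhoG_eq_card_filter_zmod {d : ℕ} [NeZero d] :
    rhoG a b c d = (Finset.univ.filter (fun x : ZMod d => (a : ZMod d) * x ^ 2 + b * x + c = 0)).card := by
  classical
  rw [← card_rootsG]
  refine Finset.card_bij (fun Θ _ => (Θ : ZMod d)) ?_ ?_ ?_
  · intro Θ hΘ
    rw [mem_rootsG] at hΘ
    rw [Finset.mem_filter]
    refine ⟨Finset.mem_univ _, ?_⟩
    have := (ZMod.intCast_zmod_eq_zero_iff_dvd (quadVal a b c Θ) d).2 hΘ.2
    simp only [quadVal] at this
    push_cast at this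
    exact this
  · intro x hx y hy h
    rw [mem_rootsG] at hx hy
    have := (ZMod.natCast_eq_natCast_iff' x y d).1 h
    rwa [Nat.mod_eq_of_lt hx.1, Nat.mod_eq_of_lt hy.1] at this
  · intro x hx
    rw [Finset.mem_filter] at hx
    refine ⟨x.val, ?_, by simp⟩
    rw [mem_rootsG]
    refine ⟨ZMod.val_lt x, ?_⟩
    rw [← ZMod.intCast_zmod_eq_zero_iff_dvd]
    simp only [quadVal]
    push_cast
    rw [ZMod.natCast_zmod_val]
    exact hx.2

/-- **The admissible classes for `𝒜_G`**: for `(d₂, 2a) = 1`, the classes `μ mod d₂` prime to `d₂`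
with `ω_G(μ)` a root of `G` mod `d₂` number `ρ_G(d₂)` if `(d₂, Δ) = 1` and `0` otherwise
(`μ ↦ ω_G(μ)` is affine with unit slope; a root `Θ` has a unit preimage iff `2aΘ + b` is a unit,
and `(2aΘ + b)² ≡ Δ (mod d₂)`). [cite: LemkeOliverActaArith2012, p. 249] -/
theorem card_admissibleG_eq (hn₁ : Squarefree n₁) (hn₂ : Squarefree n₂) (l₁ l₂ : ℕ)
    (hgood : (2 * a.natAbs).Coprime (dtwo (Nat.gcd n₁ n₂) l₁ l₂)) :
    ((Finset.range (dtwo (Nat.gcd n₁ n₂) l₁ l₂)).filter (fun μ : ℕ =>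
        μ.Coprime (dtwo (Nat.gcd n₁ n₂) l₁ l₂) ∧
        ((dtwo (Nat.gcd n₁ n₂) l₁ l₂ : ℕ) : ℤ) ∣
          quadVal a b c (omegaOfG a b (dtwo (Nat.gcd n₁ n₂) l₁ l₂) (crtc n₁ n₂ l₁ l₂) l₁ l₂ μ))).card =
      if (dtwo (Nat.gcd n₁ n₂) l₁ l₂).Coprime (b ^ 2 - 4 * a * c).natAbs then
        rhoG a b c (dtwo (Nat.gcd n₁ n₂) l₁ l₂) else 0 := by
  classical
  have hn₁0 : n₁ ≠ 0 := hn₁.ne_zero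
  set d := Nat.gcd n₁ n₂ with hd
  set d₂ := dtwo d l₁ l₂ with hd₂
  set cc := crtc n₁ n₂ l₁ l₂ with hcc
  have hdpos : 0 < d := Nat.gcd_pos_of_pos_left _ (Nat.pos_of_ne_zero hn₁0)
  have hdsq : Squarefree d := hn₁.squarefree_of_dvd (Nat.gcd_dvd_left _ _)
  have hd₂pos : 0 < d₂ := dtwo_pos hdpos l₁ l₂
  haveI : NeZero d₂ := ⟨hd₂pos.ne'⟩
  -- the units `2a`, `a`, `w₀`
  have h2a : IsUnit (2 * (a : ZMod d₂)) := by
    have : ((2 * a : ℤ) : ZMod d₂) = 2 * (a : ZMod d₂) := by push_cast; ring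
    rw [← this, ZMod.coe_int_isUnit_iff_isCoprime, Int.isCoprime_iff_gcd_eq_one, Int.gcd_eq_natAbs,
      Int.natAbs_natCast]
    have e : (2 * a).natAbs = 2 * a.natAbs := by rw [Int.natAbs_mul]; rfl
    rw [e]
    first
      | exact hgood
      | exact Nat.coprime_comm.1 hgood
  have haU : IsUnit (a : ZMod d₂) := isUnit_of_mul_isUnit_right h2a
  obtain ⟨hc₁, -, -⟩ := crtc_spec hn₂ hn₁0 l₁ l₂
  rw [← hcc] at hc₁
  have hcd₂ : cc ≡ l₁ [MOD d₂] :=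
    Nat.ModEq.of_dvd ((hd₂ ▸ dtwo_dvd d l₁ l₂).trans (Nat.gcd_dvd_left n₁ n₂)) hc₁
  have hw₀ : IsUnit (2 * (cc : ZMod d₂) - l₁ - l₂) := by
    have e : (2 * (cc : ZMod d₂) - l₁ - l₂) = (((l₁ : ℤ) - l₂ : ℤ) : ZMod d₂) := by
      have : (cc : ZMod d₂) = (l₁ : ZMod d₂) := (ZMod.natCast_eq_natCast_iff _ _ _).mpr hcd₂
      rw [this]; push_cast; ring
    rw [e, ZMod.coe_int_isUnit_iff_isCoprime, Int.isCoprime_iff_gcd_eq_one, Int.gcd_eq_natAbs,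
      Int.natAbs_natCast]
    exact (coprime_dtwo hdsq l₁ l₂).2
  set α : ZMod d₂ := (2 * (a : ZMod d₂))⁻¹ * ((a : ZMod d₂) * (2 * (cc : ZMod d₂) - l₁ - l₂)) with hα
  set β : ZMod d₂ := -((2 * (a : ZMod d₂))⁻¹ * b) with hβ
  have hinvU : IsUnit ((2 * (a : ZMod d₂))⁻¹) := IsUnit.of_mul_eq_one _ (ZMod.inv_mul_of_unit _ h2a)
  have hαU : IsUnit α := hinvU.mul (haU.mul hw₀)
  have hω : ∀ μ : ℕ, (omegaOfG a b d₂ cc l₁ l₂ μ : ZMod d₂) = α * μ + β := by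
    intro μ
    unfold omegaOfG
    rw [ZMod.natCast_zmod_val, hα, hβ]
    ring
  -- `2aω(μ) + b = μ a w₀`
  have hlin : ∀ μ : ℕ, 2 * (a : ZMod d₂) * (omegaOfG a b d₂ cc l₁ l₂ μ : ZMod d₂) + b =
      (μ : ZMod d₂) * ((a : ZMod d₂) * (2 * (cc : ZMod d₂) - l₁ - l₂)) := by
    intro μ
    rw [hω, hα, hβ]
    have h1 : 2 * (a : ZMod d₂) * (2 * (a : ZMod d₂))⁻¹ = 1 := ZMod.mul_inv_of_unit _ h2a
    linear_combination ((μ : ZMod d₂) * ((a : ZMod d₂) * (2 * (cc : ZMod d₂) - l₁ - l₂)) - b) * h1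
  -- the target set
  set T := (Finset.univ.filter (fun x : ZMod d₂ =>
    (a : ZMod d₂) * x ^ 2 + b * x + c = 0 ∧ IsUnit (2 * (a : ZMod d₂) * x + b))) with hT
  have hG : ∀ μ : ℕ, ((d₂ : ℕ) : ℤ) ∣ quadVal a b c (omegaOfG a b d₂ cc l₁ l₂ μ) ↔
      (a : ZMod d₂) * (omegaOfG a b d₂ cc l₁ l₂ μ : ZMod d₂) ^ 2 + b * (omegaOfG a b d₂ cc l₁ l₂ μ : ZMod d₂) + c = 0 := by
    intro μ
    rw [← ZMod.intCast_zmod_eq_zero_iff_dvd]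
    simp only [quadVal]
    push_cast
    rfl
  have hcard : ((Finset.range d₂).filter (fun μ : ℕ => μ.Coprime d₂ ∧
      ((d₂ : ℕ) : ℤ) ∣ quadVal a b c (omegaOfG a b d₂ cc l₁ l₂ μ))).card = T.card := by
    refine Finset.card_bij (fun μ _ => (omegaOfG a b d₂ cc l₁ l₂ μ : ZMod d₂)) ?_ ?_ ?_
    · intro μ hμ
      rw [Finset.mem_filter, Finset.mem_range] at hμ
      rw [hT, Finset.mem_filter]
      refine ⟨Finset.mem_univ _, (hG μ).1 hμ.2.2, ?_⟩
      rw [hlin]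
      exact ((ZMod.isUnit_iff_coprime μ d₂).2 hμ.2.1).mul (haU.mul hw₀)
    · intro x hx y hy hxy
      rw [Finset.mem_filter, Finset.mem_range] at hx hy
      rw [hω, hω] at hxy
      have h1 : α * (x : ZMod d₂) = α * (y : ZMod d₂) := add_right_cancel hxy
      have h2 : (x : ZMod d₂) = (y : ZMod d₂) := hαU.mul_left_cancel h1
      have := (ZMod.natCast_eq_natCast_iff' x y d₂).mp h2
      rwa [Nat.mod_eq_of_lt hx.1, Nat.mod_eq_of_lt hy.1] at this
    · intro x hx
      rw [hT, Finset.mem_filter] at hx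
      obtain ⟨-, hroot, hunit⟩ := hx
      -- `μ = (2ax + b)(a w₀)⁻¹`
      set u : ZMod d₂ := (2 * (a : ZMod d₂) * x + b) * ((haU.mul hw₀).unit⁻¹ : (ZMod d₂)ˣ) with hu
      have huU : IsUnit u := hunit.mul (Units.isUnit _)
      have hux : α * u + β = x := by
        rw [hu, hα, hβ]
        have h1 : (2 * (a : ZMod d₂))⁻¹ * (2 * (a : ZMod d₂)) = 1 := ZMod.inv_mul_of_unit _ h2a
        have h2 : ((a : ZMod d₂) * (2 * (cc : ZMod d₂) - l₁ - l₂)) * ((haU.mul hw₀).unit⁻¹ : (ZMod d₂)ˣ) = 1 :=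
          IsUnit.mul_val_inv _
        linear_combination x * h1 + ((2 * (a : ZMod d₂))⁻¹ * (2 * (a : ZMod d₂) * x + b)) * h2
      refine ⟨u.val, ?_, ?_⟩
      · rw [Finset.mem_filter, Finset.mem_range]
        refine ⟨ZMod.val_lt u, ?_, ?_⟩
        · have := ZMod.val_coe_unit_coprime huU.unit
          rw [IsUnit.unit_spec] at this
          exact this
        · rw [hG, hω, ZMod.natCast_zmod_val, hux]; exact hroot
      · rw [hω, ZMod.natCast_zmod_val, hux]
  rw [hcard]
  -- `T = roots` if `(d₂, Δ) = 1`, `T = ∅` otherwise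
  have hsq : ∀ x : ZMod d₂, (a : ZMod d₂) * x ^ 2 + b * x + c = 0 →
      (2 * (a : ZMod d₂) * x + b) ^ 2 = ((b ^ 2 - 4 * a * c : ℤ) : ZMod d₂) := by
    intro x hx
    push_cast
    linear_combination (4 * (a : ZMod d₂)) * hx
  have hunit_iff : ∀ x : ZMod d₂, (a : ZMod d₂) * x ^ 2 + b * x + c = 0 →
      (IsUnit (2 * (a : ZMod d₂) * x + b) ↔ d₂.Coprime (b ^ 2 - 4 * a * c).natAbs) := by
    intro x hx
    rw [← isUnit_pow_iff two_ne_zero, hsq x hx, ZMod.coe_int_isUnit_iff_isCoprime,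
      Int.isCoprime_iff_gcd_eq_one, Int.gcd_eq_natAbs, Int.natAbs_natCast]
  split_ifs with hΔ
  · rw [rhoG_eq_card_filter_zmod (d := d₂), hT]
    congr 1
    refine Finset.filter_congr fun x _ => ?_
    exact ⟨fun h => h.1, fun h => ⟨h, (hunit_iff x h).2 hΔ⟩⟩
  · rw [hT, Finset.card_eq_zero, Finset.filter_eq_empty_iff]
    rintro x - ⟨hroot, hunit⟩
    exact hΔ ((hunit_iff x hroot).1 hunit)

end Sum

/-! ### Multiplicativity of `ρ_G` on the pair -/

/-- For squarefree `q` and `e ∣ q`: `ρ_G(q/e) ρ_G(e) = ρ_G(q)`. [folklore] -/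
theorem rhoG_div_mul_rhoG {q e : ℕ} (hq : Squarefree q) (he : e ∣ q) :
    rhoG a b c (q / e) * rhoG a b c e = rhoG a b c q := by
  have heq : q / e * e = q := Nat.div_mul_cancel he
  have hcop : (q / e).Coprime e := by
    have := hq; rw [← heq, Nat.squarefree_mul_iff] at this; exact this.1
  rw [← rhoG_mul_of_coprime hcop, heq]

/-- For squarefree `n₁, n₂`: `ρ_G(n₁) ρ_G(n₂) = ρ_G([n₁,n₂]) ρ_G((n₁,n₂))`. [folklore] -/
theorem rhoG_mul_rhoG_eq {n₁ n₂ : ℕ} (hn₁ : Squarefree n₁) (hn₂ : Squarefree n₂) :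
    rhoG a b c n₁ * rhoG a b c n₂ = rhoG a b c (Nat.lcm n₁ n₂) * rhoG a b c (Nat.gcd n₁ n₂) := by
  have hn₁0 : n₁ ≠ 0 := hn₁.ne_zero
  obtain ⟨hcop, hlcm⟩ := coprime_div_gcd_of_squarefree hn₂ hn₁0
  set g := Nat.gcd n₁ n₂
  set e := n₂ / g
  have heg : e * g = n₂ := Nat.div_mul_cancel (Nat.gcd_dvd_right n₁ n₂)
  have hegc : e.Coprime g := by
    have := hn₂; rw [← heg, Nat.squarefree_mul_iff] at this; exact this.1
  rw [hlcm, rhoG_mul_of_coprime hcop, ← heg, rhoG_mul_of_coprime hegc]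
  ring

end Literature.NumberTheory.Sieve.Iwaniec1978

end
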